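import Summits.BirchSwinnertonDyer.BirchSwinnertonDyer.Theorems.QuadraticBranchSignedControlPlusEtaNonsurjCartanFieldCMField
import Literature.NumberTheory.EllipticCurves.DeuringOrdinaryReductionHoldsProofs
import Literature.NumberTheory.EllipticCurves.SelmerCorankControlRatProofs
import Literature.NumberTheory.EllipticCurves.NoEverywhereGoodReductionRat
import Literature.NumberTheory.EllipticCurves.OrdinaryNewformDatumCofreeUnramified
import Literature.NumberTheory.EllipticCurves.ComplexMultiplicationTwistIsogenyProofs
import HarnessLib

/-!
# Route `QuadraticBranchSignedControl` (rung K8, cell `bsd-potss`): crux stmt-BirchSwinnertonDyer-19606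
# `PlusEtaMainConjectureNonsurj` — THE ANCHOR PRIME IS INERT IN THE CM FIELD OF A CM ANCHOR (Deuring, both halves, by name):
# at `p = 5` a CM-curve anchor has CM field `ℚ(√d)`, `d ∈ {−3, −7, −8, −43, −67, −163}` — FINDING-19606-k8eta-c2-g5 §2 (c) by structure

WHAT. The v7 stub `stub_etaMC_nonCM_uncongruent` quantifies over CM ANCHORS `A`: globally minimal CM curves, good at `p ≥ 5` with
`a_p(A) = 0`, mod-`p` congruent to the row. `…CartanFieldCMField` (this seat) proved `K_V = ℚ(√d_K(A))`, `d_K(A)` one of the nine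
class-number-one discriminants. Here the anchor's OWN reduction type pins the decomposition of `p` in `ℚ(√d_K)`:

* §1 `not_cmSplit_of_hasCM_of_dvd_frobeniusTrace` — **`p` does not split**: a CM curve good at `p` with `p ∣ a_p` is supersingular at `p`,
  while at a split prime Deuring's criterion (ordinary half, the tree's DISCHARGED fact `deuring_hasUnitRootAt_of_hasCM_of_cmSplit_holds`,
  Lang Ch. 13 §4 Thm. 12) gives the unit-root condition, i.e. `p ∤ a_p` (`hasUnitRootAt_iff_not_dvd_frobeniusTrace`).
* §2 `not_cmRamified_of_hasCM_of_hasGoodReductionAtPrime` — **`p ≥ 5` is not ramified**: if `p ∣ d_K` then `p = |d_K| ∈ {7, 11, 19, 43, 67,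
  163}` and `j(A) − 1728 = c₆²/Δ` is an INTEGER exactly divisible by `p` (the seven numerical facts `−3375 − 1728 = −7·27²`, …,
  `−262537412640768000 − 1728 = −163·(2³3³7·11·19·127)²`), whereas good reduction of the global minimal model gives `p ∤ Δ_min`, so
  `c₆² = (j − 1728)·Δ_min` would be divisible by `p` exactly once — impossible (`sq_ne_mul_of_prime_dvd_once`). I.e. a CM curve over `ℚ`
  has bad reduction at every odd prime ramified in its CM field (the tree's `exists_j_eq_intCast_of_hasCM_of_cmRamified_odd` records
  `p ∣ j − 1728`; exact divisibility is what is used here).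
* §3 `cmInert_of_cmAnchor`: hence **`CMInert A p`** for every anchor; `cmFieldDiscrOfJ_mem_six_of_cmAnchor_five`: at `p = 5`,
  `d_K(A) ∈ {−3, −7, −8, −43, −67, −163}` (`−4, −11, −19` are squares mod `5`); and with `…CartanFieldCMField`:
  `exists_cartanField_eq_adjoin_geomSqrt_and_cmInert_of_cmAnchor_of_row` — on a CM-anchored row, `K_V = ℚ(√d_K)` with `p` inert
  (g10's `…CartanFieldInert` reached the inertness of `K_V` on the Galois side; here it is Deuring on the anchor).

HONEST FRAMING (cell `bsd-potss`, run/shared/lean/pub/bsd-potss/; FULL-BSD rank ≤ 1 programme): TOOL THEOREMS ONLY (no definition,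
no named fact, no `sorry`, axioms standard). Nothing is booked; crux 19606 stays OPEN; `BSD(W, p)` is claimed for no pair. Seat
`bsd-potss-k8eta-c2` g14 (prover), `--supports stmt-BirchSwinnertonDyer-19606`.

References: [Lang1987] Ch. 13 §4 Thm. 12 (Deuring's criterion); [SilvermanAEC2009] III.1 (`c₄³ − c₆² = 1728Δ`), VII.5 Prop. 5.1,
App. C §11; [SilvermanAdvancedTopics1994] App. A §3; [Cox2013] Prop. 5.16 / Cor. 5.17 (decomposition in `ℚ(√d_K)`).
-/

set_option autoImplicit false
set_option linter.dupNamespace false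

noncomputable section

open scoped Classical NumberField

open Field IsDedekindDomain NumberField WeierstrassCurve Literature.NumberTheory.EllipticCurves
  Literature.NumberTheory.EllipticCurves.Rank1Residual Rat.HeightOneSpectrum
open Summit.BirchSwinnertonDyer.Rank1Residual.O6 (ModPCongruent)

namespace Summit.BirchSwinnertonDyer.BirchSwinnertonDyer.Theorems.EtaCartanField

/-! ## §1 `p` does not split in the CM field of a CM curve supersingular at `p` -/

/-- `W.baseChange ℚ = W` for any `ℚ`-algebra structure on `ℚ` (bookkeeping). [folklore] -/
private theorem baseChange_rat_self (W : WeierstrassCurve ℚ) (inst : Algebra ℚ ℚ) :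
    @WeierstrassCurve.baseChange ℚ _ W ℚ _ inst = W := by
  rw [WeierstrassCurve.baseChange, Subsingleton.elim (@algebraMap ℚ ℚ _ _ inst) (RingHom.id ℚ), map_id]

/-- **Deuring, ordinary half, contrapositive: a CM curve good at `p` with `p ∣ a_p` has `p` NOT split in its CM field.** For `A/ℚ`
globally minimal with CM, `p` a prime of good reduction with `p ∣ a_p(A)`: `¬ CMSplit A p`. (If `p` split, the discharged fact
`deuring_hasUnitRootAt_of_hasCM_of_cmSplit_holds` over `F = ℚ` at the place above `p` gives the unit-root condition, i.e. `p ∤ a_p`.)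
[cite: Lang1987, Ch. 13 §4 Thm. 12 (p. 140)] [cite: SilvermanAEC2009, V Ex. 5.10 (a)] -/
theorem not_cmSplit_of_hasCM_of_dvd_frobeniusTrace (A : WeierstrassCurve ℚ) [A.IsElliptic] [A.IsGloballyMinimal] (p : ℕ)
    [hp : Fact p.Prime] (hCM : A.HasCM) (hgood : A.HasGoodReductionAtPrime p) (hap : (p : ℤ) ∣ A.frobeniusTrace p) :
    ¬ CMSplit A p := by
  intro hsplit
  set v : HeightOneSpectrum (𝓞 ℚ) := primesEquiv.symm ⟨p, hp.out⟩ with hv_def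
  have hv : (p : 𝓞 ℚ) ∈ v.asIdeal := by
    have h := natCast_primesEquiv_mem_asIdeal v
    rwa [hv_def, Equiv.apply_symm_apply] at h
  have hgoodAt : (A.baseChange ℚ).HasGoodReductionAt v := by
    rw [baseChange_rat_self]
    exact A.hasGoodReductionAt_of_hasGoodReductionAtPrime v hv hgood
  have hunit := deuring_hasUnitRootAt_of_hasCM_of_cmSplit_holds A hCM p hp.out hsplit ℚ v hv hgoodAt
  rw [baseChange_rat_self] at hunit
  exact (A.hasUnitRootAt_iff_not_dvd_frobeniusTrace v hp.out hv).mp hunit hap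

/-! ## §2 An odd prime `p ≥ 5` ramified in the CM field is a prime of bad reduction -/

/-- Arithmetic core: if `c² = n·Δ` in `ℤ` with `p` prime, `p ∣ n`, `p² ∤ n`, then `p ∣ Δ`. [folklore] -/
private theorem dvd_of_sq_eq_mul_of_dvd_once {p : ℕ} (hp : p.Prime) {c n Δ : ℤ} (h : c ^ 2 = n * Δ)
    (h1 : (p : ℤ) ∣ n) (h2 : ¬ (p : ℤ) ^ 2 ∣ n) : (p : ℤ) ∣ Δ := by
  have hpr : Prime (p : ℤ) := Nat.prime_iff_prime_int.mp hp
  by_contra hΔ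
  have hc : (p : ℤ) ∣ c := hpr.dvd_of_dvd_pow (n := 2) (by rw [h]; exact dvd_mul_of_dvd_left h1 Δ)
  have hc2 : (p : ℤ) ^ 2 ∣ n * Δ := by rw [← h]; exact pow_dvd_pow_of_dvd hc 2
  exact h2 (hpr.pow_dvd_of_dvd_mul_right 2 hΔ hc2)

/-- **On a global minimal model, `c₆² = (j − 1728)·Δ_min` in `ℤ`** when `j ∈ ℤ`: the relation `c₄³ − c₆² = 1728Δ` (Mathlib
`c_relation`) on the integral model, with `j = c₄³/Δ`. [cite: SilvermanAEC2009, III.1 (c₄³ − c₆² = 1728Δ, j = c₄³/Δ)] -/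
theorem integralModelInt_c₆_sq_eq (A : WeierstrassCurve ℚ) [A.IsElliptic] [A.IsGloballyMinimal] {n : ℤ} (hj : A.j = n) :
    (integralModelInt A).c₆ ^ 2 = (n - 1728) * minimalDiscriminantInt A := by
  set M := integralModelInt A with hM
  have hmap : M.map (Int.castRingHom ℚ) = A := map_integralModelInt A
  have hc₄ : A.c₄ = (M.c₄ : ℚ) := by rw [← hmap, map_c₄, eq_intCast]
  have hΔ : A.Δ = (M.Δ : ℚ) := by rw [← hmap, map_Δ, eq_intCast]
  have hΔ0 : (M.Δ : ℚ) ≠ 0 := by rw [← hΔ, ← coe_Δ']; exact A.Δ'.ne_zero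
  have hjq : (M.c₄ : ℚ) ^ 3 = (n : ℚ) * (M.Δ : ℚ) := by
    have := j_eq_c₄_pow_div A
    rw [hj, hc₄, hΔ, eq_div_iff hΔ0] at this
    exact this.symm
  have hc₄3 : M.c₄ ^ 3 = n * M.Δ := by exact_mod_cast hjq
  have hrel := M.c_relation
  change M.c₆ ^ 2 = (n - 1728) * M.Δ
  linear_combination hc₄3 + hrel

/-- **A CM curve over `ℚ` with good reduction at a prime `p ≥ 5` has `p` UNRAMIFIED in its CM field** (`¬ CMRamified A p`, i.e.
`p ∤ d_K`). If `p ∣ d_K` then (`p ≥ 5`) `p = −d_K ∈ {7, 11, 19, 43, 67, 163}`, `j(A)` is the corresponding integer of Silverman's table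
and `p ∥ j(A) − 1728` (seven numerical facts); but `c₆² = (j − 1728)·Δ_min` with `p ∤ Δ_min` (good reduction,
`not_hasGoodReductionAtPrime_of_dvd_minimalDiscriminantInt`) — a square cannot be divisible by `p` exactly once.
[cite: SilvermanAdvancedTopics1994, App. A §3] [cite: SilvermanAEC2009, App. C §11 and VII.5 Prop. 5.1] -/
theorem not_cmRamified_of_hasCM_of_hasGoodReductionAtPrime (A : WeierstrassCurve ℚ) [A.IsElliptic] [A.IsGloballyMinimal]
    (p : ℕ) [hp : Fact p.Prime] (hp5 : 5 ≤ p) (hCM : A.HasCM) (hgood : A.HasGoodReductionAtPrime p) : ¬ CMRamified A p := by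
  intro hram
  have hΔ : ¬ (p : ℤ) ∣ minimalDiscriminantInt A := fun h =>
    A.not_hasGoodReductionAtPrime_of_dvd_minimalDiscriminantInt p h hgood
  have hpp : p.Prime := hp.out
  -- `p ∣ j − 1728` exactly once forces `p ∣ Δ_min`
  have key : ∀ n : ℤ, A.j = n → (p : ℤ) ∣ n - 1728 → ¬ (p : ℤ) ^ 2 ∣ n - 1728 → False := fun n hj h1 h2 =>
    hΔ (dvd_of_sq_eq_mul_of_dvd_once hpp (integralModelInt_c₆_sq_eq A hj) h1 h2)
  have hj := (hasCM_iff_j_mem_holds A).mp hCM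
  unfold CMRamified at hram
  -- an odd prime `≥ 5` dividing `3`, `4` or `8` does not exist
  have h3 : ¬ (p : ℤ) ∣ 3 := fun h => by
    have : p ∣ 3 := by exact_mod_cast h
    have := (Nat.prime_dvd_prime_iff_eq hpp Nat.prime_three).mp this
    omega
  have h2pow : ∀ k : ℕ, ¬ (p : ℤ) ∣ (2 : ℤ) ^ k := fun k h => by
    have h' : p ∣ 2 ^ k := by exact_mod_cast h
    have := (Nat.prime_dvd_prime_iff_eq hpp Nat.prime_two).mp (hpp.dvd_of_dvd_pow h')
    omega
  have hp_eq : ∀ q : ℕ, q.Prime → (p : ℤ) ∣ (q : ℤ) → p = q := fun q hq h =>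
    (Nat.prime_dvd_prime_iff_eq hpp hq).mp (by exact_mod_cast h)
  simp only [cmJInvariants, Finset.mem_insert, Finset.mem_singleton] at hj
  rcases hj with h | h | h | h | h | h | h | h | h | h | h | h | h <;>
    rw [h] at hram <;> norm_num [cmFieldDiscrOfJ] at hram
  · exact h3 hram
  · exact h2pow 2 (by norm_num; exact hram)
  · obtain rfl := hp_eq 7 (by norm_num) hram
    exact key (-3375) h (by norm_num) (by norm_num)
  · exact h2pow 3 (by norm_num; exact hram)
  · obtain rfl := hp_eq 11 (by norm_num) hram
    exact key (-32768) h (by norm_num) (by norm_num)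
  · exact h3 hram
  · exact h2pow 2 (by norm_num; exact hram)
  · obtain rfl := hp_eq 19 (by norm_num) hram
    exact key (-884736) h (by norm_num) (by norm_num)
  · exact h3 hram
  · obtain rfl := hp_eq 7 (by norm_num) hram
    exact key 16581375 h (by norm_num) (by norm_num)
  · obtain rfl := hp_eq 43 (by norm_num) hram
    exact key (-884736000) h (by norm_num) (by norm_num)
  · obtain rfl := hp_eq 67 (by norm_num) hram
    exact key (-147197952000) h (by norm_num) (by norm_num)
  · obtain rfl := hp_eq 163 (by norm_num) hram
    exact key (-262537412640768000) h (by norm_num) (by norm_num)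

/-! ## §3 The anchor prime is inert; at `p = 5` six fields remain -/

/-- **`CMInert A p` for every CM anchor**: a globally minimal CM curve `A/ℚ` with good reduction at `p ≥ 5` and `a_p(A) = 0` has `p`
INERT in its CM field `ℚ(√d_K)` (neither ramified, §2, nor split, §1). [cite: Lang1987, Ch. 13 §4 Thm. 12] [cite: Cox2013, Prop. 5.16 and Cor. 5.17] -/
theorem cmInert_of_cmAnchor (A : WeierstrassCurve ℚ) [A.IsElliptic] [A.IsGloballyMinimal] (p : ℕ) [Fact p.Prime] (hp5 : 5 ≤ p)
    (hCM : A.HasCM) (hgood : A.HasGoodReductionAtPrime p) (hap : A.frobeniusTrace p = 0) : CMInert A p :=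
  ⟨not_cmRamified_of_hasCM_of_hasGoodReductionAtPrime A p hp5 hCM hgood,
    not_cmSplit_of_hasCM_of_dvd_frobeniusTrace A p hCM hgood (by rw [hap]; exact dvd_zero _)⟩

/-- `−4 ≡ 1²` mod `5`. [folklore] -/
private theorem isSquare_neg_four_zmod_five : IsSquare ((-4 : ℤ) : ZMod 5) := ⟨1, by decide⟩

/-- `−11 ≡ 2²` mod `5`. [folklore] -/
private theorem isSquare_neg_eleven_zmod_five : IsSquare ((-11 : ℤ) : ZMod 5) := ⟨2, by decide⟩

/-- `−19 ≡ 1²` mod `5`. [folklore] -/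
private theorem isSquare_neg_nineteen_zmod_five : IsSquare ((-19 : ℤ) : ZMod 5) := ⟨1, by decide⟩

/-- **At `p = 5`: the CM field of a CM anchor is one of SIX** — `d_K ∈ {−3, −7, −8, −43, −67, −163}` (the class-number-one discriminants
that are non-residues mod `5`; `−4 ≡ 1`, `−11 ≡ 4`, `−19 ≡ 1` are squares, `5 ∤ d` always) — FINDING-19606-k8eta-c2-g5 §2 (c)'s list,
now by structure. [cite: Cox2013, Prop. 5.16 and Cor. 5.17] [cite: SilvermanAdvancedTopics1994, App. A §3] -/
theorem cmFieldDiscrOfJ_mem_six_of_cmAnchor_five (A : WeierstrassCurve ℚ) [A.IsElliptic] [A.IsGloballyMinimal] [Fact (5 : ℕ).Prime]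
    (hCM : A.HasCM) (hgood : A.HasGoodReductionAtPrime 5) (hap : A.frobeniusTrace 5 = 0) :
    cmFieldDiscrOfJ A.j ∈ ({-3, -7, -8, -43, -67, -163} : Finset ℤ) := by
  obtain ⟨-, hns⟩ := cmInert_of_cmAnchor A 5 le_rfl hCM hgood hap
  have hnine := cmFieldDiscrOfJ_mem_nine_of_hasCM A hCM
  unfold CMSplit at hns
  simp only [Finset.mem_insert, Finset.mem_singleton] at hnine ⊢
  rcases hnine with h | h | h | h | h | h | h | h | h <;> rw [h] at hns ⊢
  · exact Or.inl rfl
  · exact absurd ⟨by decide, by rw [if_neg (by decide)]; exact isSquare_neg_four_zmod_five⟩ hns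
  · exact Or.inr (Or.inl rfl)
  · exact Or.inr (Or.inr (Or.inl rfl))
  · exact absurd ⟨by decide, by rw [if_neg (by decide)]; exact isSquare_neg_eleven_zmod_five⟩ hns
  · exact absurd ⟨by decide, by rw [if_neg (by decide)]; exact isSquare_neg_nineteen_zmod_five⟩ hns
  · exact Or.inr (Or.inr (Or.inr (Or.inl rfl)))
  · exact Or.inr (Or.inr (Or.inr (Or.inr (Or.inl rfl))))
  · exact Or.inr (Or.inr (Or.inr (Or.inr (Or.inr rfl))))

/-- **On a CM-anchored row of crux 19606: `K_V = ℚ(√d_K)` with `p` INERT in it**, the anchor read as in the v7 stub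
`stub_etaMC_nonCM_uncongruent` (`V''` globally minimal with CM, good at `p` with `a_p = 0`, `ModPCongruent V'' V p`): the Cartan field
exists, equals `ℚ⟮√d_K(V'')⟯`, `d_K(V'')` is one of the nine class-number-one discriminants and `CMInert V'' p`.
[cite: Lang1987, Ch. 10 §4 Remark and Ch. 13 §4 Thm. 12] [cite: Serre1972, §4.5] -/
theorem exists_cartanField_eq_adjoin_geomSqrt_and_cmInert_of_cmAnchor_of_row (V : WeierstrassCurve ℚ) [V.IsElliptic]
    [V.IsGloballyMinimal] (p : ℕ) [Fact p.Prime] (hp5 : 5 ≤ p) (hgood : V.HasGoodReductionAtPrime p)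
    (hap : V.frobeniusTrace p = 0) (hns : ¬ ∀ m : ℕ, V.HasSurjectiveModNGaloisRep (p ^ m : ℕ))
    {A : WeierstrassCurve ℚ} [A.IsElliptic] [A.IsGloballyMinimal] (hCM : A.HasCM) (hgoodA : A.HasGoodReductionAtPrime p)
    (hapA : A.frobeniusTrace p = 0) (hAV : ModPCongruent A V p) :
    ∃ K : IntermediateField ℚ (AlgebraicClosure ℚ), Module.finrank ℚ K = 2 ∧
      (∀ σ : absoluteGaloisGroup ℚ, σ ∈ K.fixingSubgroup ↔
        ∀ (τ : absoluteGaloisGroup ℚ) (P : V.geomTorsion p), σ • ((τ * τ) • P) = (τ * τ) • (σ • P)) ∧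
      K = IntermediateField.adjoin ℚ {geomSqrt ((cmFieldDiscrOfJ A.j : ℤ) : ℚ)} ∧
      cmFieldDiscrOfJ A.j ∈ ({-3, -4, -7, -8, -11, -19, -43, -67, -163} : Finset ℤ) ∧ CMInert A p := by
  have hVA : ModPCongruent V A p := by
    obtain ⟨e, he⟩ := hAV
    refine ⟨e.symm, fun σ P => e.injective ?_⟩
    rw [e.apply_symm_apply, he, e.apply_symm_apply]
  obtain ⟨K, hK2, hK, hKeq, hnine⟩ := exists_cartanField_eq_adjoin_geomSqrt_of_cmAnchor_of_row V p hp5 hgood hap hns hCM hVA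
  exact ⟨K, hK2, hK, hKeq, hnine, cmInert_of_cmAnchor A p hp5 hCM hgoodA hapA⟩

end Summit.BirchSwinnertonDyer.BirchSwinnertonDyer.Theorems.EtaCartanField

end
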